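import Mathlib.Computability.NFA
import Mathlib.Algebra.Order.Ring.Defs
import Mathlib.Algebra.Order.BigOperators.Group.Finset
import Mathlib.Algebra.Order.Group.Abs
import Mathlib.Algebra.Module.LinearMap.End
import Mathlib.LinearAlgebra.Matrix.ToLin
import Mathlib.Data.Finset.Lattice.Fold
import Mathlib.RingTheory.MvPolynomial.Homogeneous
import Mathlib.Algebra.MvPolynomial.Monad
import Mathlib.Algebra.Ring.SumsOfSquares
import Mathlib.Tactic.Linarith
import Mathlib.Tactic.Ring
import HarnessLib

/-!
# Path-complete graph Lyapunov functions (Ahmadi–Jungers–Parrilo–Roozbehani)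

Topic `Literature/Dynamics/SwitchedSystems` (definition item `defn-IsPathCompleteLyapunov`, wanted by
route `PneNP/LyapunovRefutations`, items `SosLyapunovDegreeLowerBound`, `TBPolyhedralToLayered`).
Companion files: `JointSpectralRadius.lean` (the Rota–Strang joint spectral radius `ρ(𝒜)` of a
finite family) and `PathCompleteLyapunovJSR.lean` (AJPR's Theorem 2.4: a path-complete graph
Lyapunov function with positive definite, continuous, homogeneous node functions certifies
`ρ(𝒜) ≤ γ`).

A **switched linear system** `x_{k+1} = A_{σ(k)} x_k` is driven by a finite alphabet `σ` of letters
`b`, each acting on the state space `E` by a map `A b : E → E` (a matrix `A b *ᵥ ·`, a linear map,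
…).  Ahmadi–Jungers–Parrilo–Roozbehani [AhmadiEtAl2014, §2] certify stability under ARBITRARY
switching by several Lyapunov functions `V i : E → 𝕜` sitting at the nodes `i` of a finite directed
graph whose edges are labelled by letters: an edge `i ⟶ j` labelled `b` encodes the Lyapunov
inequality `V j (A b x) ≤ V i (x)` [AhmadiEtAl2014, Def. 2.3], and the set of inequalities proves
stability as soon as the graph is **path-complete**: every finite word is the label sequence of
some directed path [AhmadiEtAl2014, Def. 2.2, Thm. 2.4].  Common Lyapunov functions (one node, one
loop per letter), max/min-of-quadratics, and the Lee–Dullerud / Daafouz–Bernussou LMIs are all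
special path-complete graphs [AhmadiEtAl2014, §3].

## Contents and conventions (chosen to match the consumers literally)

* Words are `w : List σ` in TIME order: the head letter acts first.  `wordAct A w x` is the state
  reached from `x` (`A w[k-1] (⋯ (A w[0] x))`), `prodWord A w = A w[k-1] * ⋯ * A w[0]` the same
  product in a monoid (matrices, endomorphisms); AJPR write this word `A_{σ_k} ⋯ A_{σ_1}` and read
  it from right to left [AhmadiEtAl2014, §2, first paragraph].
* `LabeledDigraph σ N`: a directed graph on the node type `N` with edges labelled by single
  letters (`G.edge i b j`).  AJPR allow labels that are words and reduce to single letters by the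
  *expanded graph* [AhmadiEtAl2014, Def. 2.1]; only the expanded (length-one) form is formalised,
  which is what the consumers ask for.  `G.HasPath i w j` (a directed path from `i` to `j` with
  label sequence `w`), `G.IsPathComplete` [AhmadiEtAl2014, Def. 2.2], the automaton view
  `G.toNFA` (all nodes initial and accepting; `isPathComplete_iff_forall_mem_accepts` is AJPR's
  remark that path-completeness is universality of this NFA) and the node-sequence view
  `hasPath_iff_exists_seq`.
* `IsGraphLyapunovFunction G A K c V`: for every edge `i —b→ j` and every `x ∈ K`,
  `V j (A b x) ≤ c * V i x`.  AJPR's Definition 2.3 is `K = univ`, `c = 1` applied to the SCALED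
  family `γ • A` [AhmadiEtAl2014, Thm. 2.4]; for node functions positively homogeneous of degree
  `D` this is our inequality with factor `c = γ⁻ᴰ`, i.e. RATE `γ⁻¹`.  We keep an explicit factor
  `c` (so `c = r` for degree-one templates with rate `r`, `c = r ^ (2d)` for degree-`2d` forms, as
  in [ParriloJadbabaie2008, Thm. 2.2]) and an explicit domain `K` (the whole space, or an
  invariant cone such as the nonnegative orthant for entrywise-nonnegative families — the
  *copositive* setting of [MasonShorten2007]).
* `IsPathCompleteLyapunov G A K c V` = path-complete ∧ graph Lyapunov function: THE notion.
  Soundness in orbit form is PROVED here (`IsGraphLyapunovFunction.apply_wordAct_le`,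
  `IsPathCompleteLyapunov.exists_apply_wordAct_le`): along a path labelled `w` from `i` to `j`,
  `V j (A_w x) ≤ c ^ |w| * V i x`.  The joint-spectral-radius form (AJPR Thm. 2.4) is proved in
  `PathCompleteLyapunovJSR.lean`.
* Node-function TEMPLATES (the "proof lines" of the certificate classes), with their size measures:
  `maxOfLinearForms p` — pointwise max of finitely many linear forms indexed by a finite type `L`
  (polyhedral / polytopic template [AthanasopoulosJungers2019, §III, (8)]; on the nonnegative orthant
  `nonnegOrthant ι 𝕜` the max-type copositive template, the one-piece case being the linear
  copositive function `v ⬝ᵥ x` of [MasonShorten2007]); number of pieces = `Fintype.card L`;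
  the Lyapunov inequality between two such nodes is piecewise domination
  (`maxOfLinearForms_le_mul_maxOfLinearForms_iff`).  `polytopicSeminorm P x = max_r |(P x)_r|`
  (`‖P x‖_∞`, `2 · (rows of P)` pieces).  `quadraticForm Q x = x ⬝ᵥ Q x` [AhmadiEtAl2014, §1].
  `IsSosLyapunovCertificate A γ d p` — the Parrilo–Jadbabaie programme: `p` a form of degree
  `2d`, `p - ε (∑ xᵢ²)ᵈ` and `γ^{2d} p - p ∘ A_b` sums of squares [ParriloJadbabaie2008, §2.1
  (the relaxation `ρ_{SOS,2d}`) and Rem. 2.5]; size = the degree `2d`.  Each template comes with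
  the API actually needed downstream (homogeneity, nonnegativity of SOS values, the induced graph
  Lyapunov inequality).
* Size of a certificate: number of nodes `Fintype.card N`, pieces `∑ i, Fintype.card (L i)`,
  degree `2d`; no bundled "certificate" structure is imposed — consumers quantify over
  `(N) [Fintype N] (G : LabeledDigraph σ N) (V …)` directly.

## What is NOT here

The joint spectral radius and Theorem 2.4 (companion files); converse Lyapunov theorems and the
comparison ("who beats whom") of path-complete graphs [AhmadiEtAl2014, §§4–5]; De Bruijn graphs;
the SDP/LP formulations as optimisation problems.
-/

namespace Literature.Dynamics.SwitchedSystems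

/-! ### Words acting on states -/

section Words

variable {σ : Type*} {E : Type*} {R : Type*}

/-- The action of the word `w = [b₀, …, b_{k-1}]` (time order: `b₀` acts first) on a state:
`wordAct A w x = A b_{k-1} (⋯ (A b₀ x))`, i.e. the state of the switched system
`x_{t+1} = A_{w t} x_t` after reading `w` from `x` [AthanasopoulosJungers2019, Def. 1, (1)].
[cite: AhmadiEtAl2014, §1 (the switched linear system)] -/
def wordAct (A : σ → E → E) : List σ → E → E
  | [], x => x
  | b :: w, x => wordAct A w (A b x)

/-- The empty word does nothing. [folklore] -/
@[simp] theorem wordAct_nil (A : σ → E → E) (x : E) : wordAct A [] x = x := rfl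

/-- The head letter acts first. [folklore] -/
@[simp] theorem wordAct_cons (A : σ → E → E) (b : σ) (w : List σ) (x : E) :
    wordAct A (b :: w) x = wordAct A w (A b x) := rfl

/-- `wordAct` is a left fold. [folklore] -/
theorem wordAct_eq_foldl (A : σ → E → E) (w : List σ) (x : E) :
    wordAct A w x = w.foldl (fun y b => A b y) x := by
  induction w generalizing x with
  | nil => rfl
  | cons b w ih => simp [ih]

/-- Reading `u` then `v`. [folklore] -/
@[simp] theorem wordAct_append (A : σ → E → E) (u v : List σ) (x : E) :
    wordAct A (u ++ v) x = wordAct A v (wordAct A u x) := by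
  induction u generalizing x with
  | nil => rfl
  | cons b u ih => simp [ih]

/-- The product of the word `w = [b₀, …, b_{k-1}]` in a monoid (matrices, endomorphisms):
`prodWord A w = A b_{k-1} * ⋯ * A b₀` — AJPR's `A_{σ_k} ⋯ A_{σ_1}`, the factor acting first
written rightmost.  (`wordProd` of `TsitsiklisBlondel.lean` is the same product for the alphabet
`Bool` and matrices, written as a left fold; `prodWord_eq_foldl` is the bridge.)
[cite: AhmadiEtAl2014, §2] -/
def prodWord [Monoid R] (A : σ → R) : List σ → R
  | [] => 1
  | b :: w => prodWord A w * A b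

/-- The empty product. [folklore] -/
@[simp] theorem prodWord_nil [Monoid R] (A : σ → R) : prodWord A [] = 1 := rfl

/-- The head letter is the rightmost factor. [folklore] -/
@[simp] theorem prodWord_cons [Monoid R] (A : σ → R) (b : σ) (w : List σ) :
    prodWord A (b :: w) = prodWord A w * A b := rfl

/-- One-letter words. [folklore] -/
theorem prodWord_singleton [Monoid R] (A : σ → R) (b : σ) : prodWord A [b] = A b := by simp

/-- [folklore] -/
@[simp] theorem prodWord_append [Monoid R] (A : σ → R) (u v : List σ) :
    prodWord A (u ++ v) = prodWord A v * prodWord A u := by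
  induction u with
  | nil => simp
  | cons b u ih => simp [ih, mul_assoc]

/-- `prodWord A w` is the product of the reversed list of letters. [folklore] -/
theorem prodWord_eq_prod_reverse [Monoid R] (A : σ → R) (w : List σ) :
    prodWord A w = (w.reverse.map A).prod := by
  induction w with
  | nil => simp
  | cons b w ih => simp [ih]

/-- `prodWord` as a left fold (the form used for `wordProd` in `TsitsiklisBlondel.lean`).
[folklore] -/
theorem prodWord_eq_foldl [Monoid R] (A : σ → R) (w : List σ) :
    prodWord A w = w.foldl (fun M b => A b * M) 1 := by
  suffices h : ∀ M : R, prodWord A w * M = w.foldl (fun M b => A b * M) M by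
    simpa using h 1
  induction w with
  | nil => intro M; simp
  | cons b w ih => intro M; simp [← ih (A b * M), mul_assoc]

/-- For a monoid acting on the states, the product of the word acts as the word.
(E.g. `R = Module.End 𝕜 E` or `E →L[𝕜] E` acting by application.) [folklore] -/
theorem prodWord_smul [Monoid R] [MulAction R E] (A : σ → R) (w : List σ) (x : E) :
    prodWord A w • x = wordAct (fun b y => A b • y) w x := by
  induction w generalizing x with
  | nil => simp
  | cons b w ih => simp [mul_smul, ih]

/-- Matrix version: `prodWord A w *ᵥ x` is the state reached by the word. [folklore] -/
theorem prodWord_mulVec {ι : Type*} [Fintype ι] [DecidableEq ι] [Semiring R]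
    (A : σ → Matrix ι ι R) (w : List σ) (x : ι → R) :
    (prodWord A w).mulVec x = wordAct (fun b y => (A b).mulVec y) w x := by
  induction w generalizing x with
  | nil => simp
  | cons b w ih => simp [← ih, Matrix.mulVec_mulVec]

end Words

/-! ### Labelled directed graphs, paths, path-completeness -/

/-- A directed graph on the node type `N` whose edges are labelled by single letters of the
alphabet `σ`: `G.edge i b j` means "there is an edge from node `i` to node `j` labelled `b`"
(several differently-labelled edges between the same nodes are allowed).  These are the labelled
graphs `G(N, E)` of Ahmadi–Jungers–Parrilo–Roozbehani with labels of length one, i.e. graphs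
equal to their own *expanded graph*. [cite: AhmadiEtAl2014, §2, Def. 2.1] -/
@[ext]
structure LabeledDigraph (σ : Type*) (N : Type*) where
  /-- `edge i b j`: an edge from node `i` to node `j` carrying the label `b`. -/
  edge : N → σ → N → Prop

namespace LabeledDigraph

variable {σ : Type*} {N : Type*} (G : LabeledDigraph σ N)

/-- `G.HasPath i w j`: there is a directed path in `G` from node `i` to node `j` whose successive
edge labels are the letters of `w` in order (the first edge carries `w[0]`).  For `w = []` this is
`i = j`. [cite: AhmadiEtAl2014, §2, Def. 2.2] -/
def HasPath (G : LabeledDigraph σ N) : N → List σ → N → Prop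
  | i, [], j => i = j
  | i, b :: w, j => ∃ i', G.edge i b i' ∧ G.HasPath i' w j

/-- The empty path. [folklore] -/
@[simp] theorem hasPath_nil {i j : N} : G.HasPath i [] j ↔ i = j := Iff.rfl

/-- A path starts with an edge carrying the first letter. [folklore] -/
@[simp] theorem hasPath_cons {i j : N} {b : σ} {w : List σ} :
    G.HasPath i (b :: w) j ↔ ∃ i', G.edge i b i' ∧ G.HasPath i' w j := Iff.rfl

/-- One-edge paths. [folklore] -/
theorem hasPath_singleton {i j : N} {b : σ} : G.HasPath i [b] j ↔ G.edge i b j := by simp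

/-- Paths concatenate. [folklore] -/
theorem hasPath_append {i j : N} {u v : List σ} :
    G.HasPath i (u ++ v) j ↔ ∃ k, G.HasPath i u k ∧ G.HasPath k v j := by
  induction u generalizing i with
  | nil => simp
  | cons b u ih =>
    simp only [List.cons_append, hasPath_cons, ih]
    constructor
    · rintro ⟨i', he, k, hu, hv⟩
      exact ⟨k, ⟨i', he, hu⟩, hv⟩
    · rintro ⟨k, ⟨i', he, hu⟩, hv⟩
      exact ⟨i', he, k, hu, hv⟩

/-- Node-sequence form of a path: nodes `v 0 = i, v 1, …, v |w| = j` with an edge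
`v k —w[k]→ v (k+1)` for every `k < |w|` (values of `v` beyond `|w|` are irrelevant). [folklore] -/
theorem hasPath_iff_exists_seq {i j : N} {w : List σ} :
    G.HasPath i w j ↔ ∃ v : ℕ → N, v 0 = i ∧ v w.length = j ∧
      ∀ (k : ℕ) (hk : k < w.length), G.edge (v k) w[k] (v (k + 1)) := by
  induction w generalizing i with
  | nil =>
    constructor
    · intro h
      exact ⟨fun _ => i, rfl, h, fun k hk => absurd hk (Nat.not_lt_zero k)⟩
    · rintro ⟨v, h0, hl, -⟩
      exact h0.symm.trans hl
  | cons b w ih =>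
    constructor
    · rintro ⟨i', he, hp⟩
      obtain ⟨v, h0, hl, hv⟩ := ih.1 hp
      refine ⟨fun k => match k with | 0 => i | k + 1 => v k, rfl, by simpa using hl, ?_⟩
      intro k hk
      cases k with
      | zero => simpa [h0] using he
      | succ k => simpa using hv k (by simpa using hk)
    · rintro ⟨v, h0, hl, hv⟩
      have h1 : G.edge i b (v 1) := by
        have := hv 0 (by simp)
        rw [List.getElem_cons_zero, h0] at this
        exact this
      refine ⟨v 1, h1, ih.2 ⟨fun k => v (k + 1), rfl, ?_, ?_⟩⟩
      · simpa using hl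
      · intro k hk
        have := hv (k + 1) (by simpa using hk)
        rw [List.getElem_cons_succ] at this
        exact this

/-- **Path-completeness** [AhmadiEtAl2014, Def. 2.2]: every finite word over `σ` is the label
sequence of some directed path of `G`. [cite: AhmadiEtAl2014, §2, Def. 2.2] -/
def IsPathComplete (G : LabeledDigraph σ N) : Prop :=
  ∀ w : List σ, ∃ i j, G.HasPath i w j

/-- The nondeterministic finite automaton of a labelled digraph: states = nodes, transitions =
labelled edges, EVERY node both initial and accepting (AJPR's "auxiliary start node with free
transitions to every node, all other nodes accepting"). [cite: AhmadiEtAl2014, §2, after Def. 2.2] -/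
def toNFA (G : LabeledDigraph σ N) : NFA σ N where
  step i b := {j | G.edge i b j}
  start := Set.univ
  accept := Set.univ

/-- Transitions of `G.toNFA` are the labelled edges. [folklore] -/
@[simp] theorem toNFA_step (i : N) (b : σ) : G.toNFA.step i b = {j | G.edge i b j} := rfl

/-- Every node is initial. [folklore] -/
@[simp] theorem toNFA_start : G.toNFA.start = Set.univ := rfl

/-- Every node is accepting. [folklore] -/
@[simp] theorem toNFA_accept : G.toNFA.accept = Set.univ := rfl

/-- Paths are runs of the automaton. [folklore] -/
theorem hasPath_iff_mem_evalFrom {i j : N} {w : List σ} :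
    G.HasPath i w j ↔ j ∈ G.toNFA.evalFrom {i} w := by
  induction w generalizing i with
  | nil => simp [eq_comm]
  | cons b w ih =>
    rw [hasPath_cons, NFA.evalFrom_cons, NFA.stepSet_singleton, NFA.mem_evalFrom_iff_exists]
    simp only [ih, toNFA_step, Set.mem_setOf_eq]

/-- A word is accepted by `G.toNFA` iff it labels some path. [folklore] -/
theorem mem_accepts_toNFA_iff {w : List σ} : w ∈ G.toNFA.accepts ↔ ∃ i j, G.HasPath i w j := by
  rw [NFA.mem_accepts]
  simp only [toNFA_accept, Set.mem_univ, true_and, toNFA_start]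
  constructor
  · rintro ⟨j, hj⟩
    obtain ⟨i, -, hi⟩ := NFA.mem_evalFrom_iff_exists.1 hj
    exact ⟨i, j, G.hasPath_iff_mem_evalFrom.2 hi⟩
  · rintro ⟨i, j, h⟩
    exact ⟨j, NFA.mem_evalFrom_iff_exists.2 ⟨i, Set.mem_univ i, G.hasPath_iff_mem_evalFrom.1 h⟩⟩

/-- AJPR's automaton criterion: `G` is path-complete iff the NFA with all nodes initial and
accepting accepts every word (universality, decidable by the subset construction).
[cite: AhmadiEtAl2014, §2, after Def. 2.2] -/
theorem isPathComplete_iff_forall_mem_accepts :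
    G.IsPathComplete ↔ ∀ w : List σ, w ∈ G.toNFA.accepts := by
  simp only [IsPathComplete, mem_accepts_toNFA_iff]

/-- In a path-complete graph every node count is positive: some node exists. [folklore] -/
theorem IsPathComplete.nonempty (h : G.IsPathComplete) : Nonempty N := by
  obtain ⟨i, -, -⟩ := h []
  exact ⟨i⟩

/-- The **complete labelled digraph** on `N`: an edge `i —b→ j` for all `i, j, b`.  On a single
node (`N = Unit`: one node with a self-loop per letter, AJPR's graph `H₁`) its graph Lyapunov
functions are exactly the COMMON Lyapunov functions `V (A b x) ≤ c * V x`.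
[cite: AhmadiEtAl2014, §2, graph H₁ after Rem. 2.1] -/
protected def complete (σ : Type*) (N : Type*) : LabeledDigraph σ N where
  edge _ _ _ := True

/-- All edges are present in the complete labelled digraph. [folklore] -/
@[simp] theorem complete_edge (i j : N) (b : σ) : (LabeledDigraph.complete σ N).edge i b j :=
  trivial

/-- In the complete labelled digraph every word labels a path from every node. [folklore] -/
theorem hasPath_complete [Nonempty N] (i : N) (w : List σ) :
    ∃ j, (LabeledDigraph.complete σ N).HasPath i w j := by
  induction w generalizing i with
  | nil => exact ⟨i, rfl⟩
  | cons b w ih =>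
    obtain ⟨j, hj⟩ := ih i
    exact ⟨j, i, trivial, hj⟩

/-- The complete labelled digraph on a nonempty node set is path-complete. [folklore] -/
theorem isPathComplete_complete [Nonempty N] : (LabeledDigraph.complete σ N).IsPathComplete := by
  intro w
  obtain ⟨i⟩ := ‹Nonempty N›
  obtain ⟨j, hj⟩ := hasPath_complete i w
  exact ⟨i, j, hj⟩

end LabeledDigraph

/-! ### Graph Lyapunov functions and the path-complete Lyapunov certificate -/

section GraphLyapunov

variable {σ : Type*} {N : Type*} {E : Type*} {𝕜 : Type*}

/-- **Graph Lyapunov function** [AhmadiEtAl2014, Def. 2.3] for the family of maps `A b : E → E`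
on the labelled digraph `G`, with multiplicative factor `c` and on the domain `K ⊆ E`: for every
edge `i —b→ j` of `G` and every `x ∈ K`, `V j (A b x) ≤ c * V i x`.
AJPR's definition is the case `K = univ`, `c = 1` for the scaled family `x ↦ γ • A b x`; for node
functions positively homogeneous of degree `D` that is this predicate with `c = (γ⁻¹) ^ D`
(see the module docstring); Athanasopoulos–Jungers write the inequalities exactly in this rate
form, `V_d (A_σ x) ≤ ε^{|σ|} V_s (x)` [AthanasopoulosJungers2019, Def. 3, (5)].  `K` a proper
cone invariant under every `A b` is the constrained / copositive setting (linear copositive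
functions `v ⬝ᵥ x` on the nonnegative orthant [MasonShorten2007]).
[cite: AhmadiEtAl2014, §2, Def. 2.3] -/
def IsGraphLyapunovFunction [LE 𝕜] [Mul 𝕜] (G : LabeledDigraph σ N) (A : σ → E → E) (K : Set E)
    (c : 𝕜) (V : N → E → 𝕜) : Prop :=
  ∀ ⦃i : N⦄ ⦃b : σ⦄ ⦃j : N⦄, G.edge i b j → ∀ ⦃x : E⦄, x ∈ K → V j (A b x) ≤ c * V i x

/-- **Path-complete graph Lyapunov function** (the certificate): `G` is path-complete
[AhmadiEtAl2014, Def. 2.2] and `V` is a graph Lyapunov function for `A` on `G` with factor `c`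
on `K` [AhmadiEtAl2014, Def. 2.3].  With positive definite, continuous, degree-`D`-homogeneous
node functions on `K = univ` it certifies `jointSpectralRadius ≤ c ^ (1/D)`
[AhmadiEtAl2014, Thm. 2.4] (proved in `PathCompleteLyapunovJSR.lean`); the orbit form of
soundness is `IsPathCompleteLyapunov.exists_apply_wordAct_le` below.
[cite: AhmadiEtAl2014, §2, Def. 2.2–2.3 and Thm. 2.4] -/
structure IsPathCompleteLyapunov [LE 𝕜] [Mul 𝕜] (G : LabeledDigraph σ N) (A : σ → E → E)
    (K : Set E) (c : 𝕜) (V : N → E → 𝕜) : Prop where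
  isPathComplete : G.IsPathComplete
  isGraphLyapunovFunction : IsGraphLyapunovFunction G A K c V

/-- On the one-node complete graph a graph Lyapunov function is a COMMON Lyapunov function:
`V (A b x) ≤ c * V x` for every letter ("graph `H₁` … corresponds to the well-known common
Lyapunov function approach"). [cite: AhmadiEtAl2014, §2, graph H₁ after Rem. 2.1] -/
theorem isGraphLyapunovFunction_complete_unit_iff [LE 𝕜] [Mul 𝕜] {A : σ → E → E} {K : Set E}
    {c : 𝕜} {V : Unit → E → 𝕜} :
    IsGraphLyapunovFunction (LabeledDigraph.complete σ Unit) A K c V ↔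
      ∀ b, ∀ ⦃x⦄, x ∈ K → V () (A b x) ≤ c * V () x := by
  constructor
  · intro h b x hx
    exact h (i := ()) (j := ()) trivial hx
  · rintro h ⟨⟩ b ⟨⟩ - x hx
    exact h b hx

/-- A common Lyapunov function is a path-complete graph Lyapunov function on the one-node
complete graph. [cite: AhmadiEtAl2014, §2, graph H₁ after Rem. 2.1] -/
theorem IsPathCompleteLyapunov.of_common [LE 𝕜] [Mul 𝕜] {A : σ → E → E} {K : Set E} {c : 𝕜}
    {V : E → 𝕜} (h : ∀ b, ∀ ⦃x⦄, x ∈ K → V (A b x) ≤ c * V x) :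
    IsPathCompleteLyapunov (LabeledDigraph.complete σ Unit) A K c (fun _ => V) :=
  ⟨LabeledDigraph.isPathComplete_complete, isGraphLyapunovFunction_complete_unit_iff.2 h⟩

variable [Semiring 𝕜] [PartialOrder 𝕜] [IsOrderedRing 𝕜]

/-- Words preserve an invariant domain. [folklore] -/
theorem wordAct_mem {A : σ → E → E} {K : Set E} (hK : ∀ b, Set.MapsTo (A b) K K) (w : List σ)
    {x : E} (hx : x ∈ K) : wordAct A w x ∈ K := by
  induction w generalizing x with
  | nil => exact hx
  | cons b w ih => exact ih (hK b hx)

/-- **Soundness, orbit form** (the chain of Lyapunov inequalities along a path, the heart of the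
proof of [AhmadiEtAl2014, Thm. 2.4]): if `V` is a graph Lyapunov function with factor `c ≥ 0` on
an invariant domain `K`, then along every directed path `i —w→ j`,
`V j (A_w x) ≤ c ^ |w| * V i x` for all `x ∈ K`. [cite: AhmadiEtAl2014, §2, proof of Thm. 2.4] -/
theorem IsGraphLyapunovFunction.apply_wordAct_le {G : LabeledDigraph σ N} {A : σ → E → E}
    {K : Set E} {c : 𝕜} {V : N → E → 𝕜} (h : IsGraphLyapunovFunction G A K c V)
    (hK : ∀ b, Set.MapsTo (A b) K K) (hc : 0 ≤ c) {i j : N} {w : List σ} (hp : G.HasPath i w j)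
    {x : E} (hx : x ∈ K) : V j (wordAct A w x) ≤ c ^ w.length * V i x := by
  induction w generalizing i x with
  | nil =>
    cases hp
    simp
  | cons b w ih =>
    obtain ⟨i', he, hp'⟩ := hp
    calc V j (wordAct A (b :: w) x) = V j (wordAct A w (A b x)) := rfl
      _ ≤ c ^ w.length * V i' (A b x) := ih hp' (hK b hx)
      _ ≤ c ^ w.length * (c * V i x) := mul_le_mul_of_nonneg_left (h he hx) (pow_nonneg hc _)
      _ = c ^ (b :: w).length * V i x := by rw [List.length_cons, pow_succ, mul_assoc]

/-- When the domain is the whole space no invariance hypothesis is needed.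
[cite: AhmadiEtAl2014, §2, proof of Thm. 2.4] -/
theorem IsGraphLyapunovFunction.apply_wordAct_le_univ {G : LabeledDigraph σ N} {A : σ → E → E}
    {c : 𝕜} {V : N → E → 𝕜} (h : IsGraphLyapunovFunction G A Set.univ c V) (hc : 0 ≤ c)
    {i j : N} {w : List σ} (hp : G.HasPath i w j) (x : E) :
    V j (wordAct A w x) ≤ c ^ w.length * V i x :=
  h.apply_wordAct_le (fun b => Set.mapsTo_univ (A b) _) hc hp (Set.mem_univ x)

/-- **Soundness of a path-complete graph Lyapunov function, orbit form**: for EVERY word `w`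
there are nodes `i, j` with `V j (A_w x) ≤ c ^ |w| * V i x` on `K`.  With finitely many positive
definite homogeneous node functions this bounds `‖A_w‖` by `const · c^{|w|/D}` uniformly in `w`,
whence `ρ(𝒜) ≤ c^{1/D}` [AhmadiEtAl2014, Thm. 2.4]. [cite: AhmadiEtAl2014, §2, proof of Thm. 2.4] -/
theorem IsPathCompleteLyapunov.exists_apply_wordAct_le {G : LabeledDigraph σ N} {A : σ → E → E}
    {K : Set E} {c : 𝕜} {V : N → E → 𝕜} (h : IsPathCompleteLyapunov G A K c V)
    (hK : ∀ b, Set.MapsTo (A b) K K) (hc : 0 ≤ c) (w : List σ) :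
    ∃ i j, G.HasPath i w j ∧ ∀ ⦃x⦄, x ∈ K → V j (wordAct A w x) ≤ c ^ w.length * V i x := by
  obtain ⟨i, j, hp⟩ := h.isPathComplete w
  exact ⟨i, j, hp, fun x hx => h.isGraphLyapunovFunction.apply_wordAct_le hK hc hp hx⟩

/-- Monotonicity in the factor: a certificate with factor `c` is one with any factor `c' ≥ c`
(when the node functions are nonnegative on `K`). [folklore] -/
theorem IsGraphLyapunovFunction.mono {G : LabeledDigraph σ N} {A : σ → E → E} {K : Set E}
    {c c' : 𝕜} {V : N → E → 𝕜} (h : IsGraphLyapunovFunction G A K c V) (hcc' : c ≤ c')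
    (hV : ∀ i, ∀ ⦃x⦄, x ∈ K → 0 ≤ V i x) : IsGraphLyapunovFunction G A K c' V :=
  fun i _b _j he _x hx => (h he hx).trans (mul_le_mul_of_nonneg_right hcc' (hV i hx))

end GraphLyapunov

/-! ### Node-function templates and their sizes -/

section Size

/-- **Size of a piecewise certificate**: total number of pieces `∑ i, card (L i)` when node `i`
carries a max of `card (L i)` linear forms (nodes × pieces for uniform templates); together with
the number of nodes `Fintype.card N` and, for polynomial templates, the degree, these are the
size measures in which lower bounds on Lyapunov certificates are stated (number of pieces of
polytopic / piecewise quadratic Lyapunov functions, degree of polynomial ones, as in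
[AhmadiJungers2016]). [folklore] -/
def numPieces (N : Type*) (L : N → Type*) [Fintype N] [∀ i, Fintype (L i)] : ℕ :=
  ∑ i, Fintype.card (L i)

/-- Uniform templates: nodes × pieces. [folklore] -/
theorem numPieces_const (N L : Type*) [Fintype N] [Fintype L] :
    numPieces N (fun _ => L) = Fintype.card N * Fintype.card L := by
  simp [numPieces]

end Size

section MaxOfLinearForms

variable {𝕜 : Type*} {E : Type*} {L L' : Type*}
variable [Semiring 𝕜] [LinearOrder 𝕜] [AddCommMonoid E] [Module 𝕜 E]
variable [Fintype L] [Nonempty L] [Fintype L'] [Nonempty L']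

/-- **Max-of-linear-forms template** (polyhedral / polytopic piecewise-linear Lyapunov function
candidate): `maxOfLinearForms p x = max_{l} p l x` for finitely many linear forms `p l` indexed by
a finite nonempty type `L` — the Minkowski functional `V(x) = maxᵢ (Gx)ᵢ / wᵢ` of the polytope
`{x | Gx ≤ w}` [AthanasopoulosJungers2019, §III, (6)–(8)]; its SIZE is the number of pieces
`Fintype.card L` (rows of `G`).  On `K = univ` with pieces closed under negation this is a
polytopic (semi)norm `‖P x‖_∞`; on the nonnegative orthant it is the max-type copositive
template, whose one-piece case is a linear copositive function `x ↦ v ⬝ᵥ x` [MasonShorten2007].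
[cite: AthanasopoulosJungers2019, §III, (8)] -/
def maxOfLinearForms (p : L → E →ₗ[𝕜] 𝕜) (x : E) : 𝕜 :=
  Finset.univ.sup' Finset.univ_nonempty fun l => p l x

/-- Each piece is below the max. [folklore] -/
theorem le_maxOfLinearForms (p : L → E →ₗ[𝕜] 𝕜) (x : E) (l : L) :
    p l x ≤ maxOfLinearForms p x :=
  Finset.le_sup' (fun l => p l x) (Finset.mem_univ l)

/-- The max is below `a` iff every piece is. [folklore] -/
theorem maxOfLinearForms_le_iff {p : L → E →ₗ[𝕜] 𝕜} {x : E} {a : 𝕜} :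
    maxOfLinearForms p x ≤ a ↔ ∀ l, p l x ≤ a := by
  simp [maxOfLinearForms, Finset.sup'_le_iff]

/-- The max is attained at some piece. [folklore] -/
theorem exists_maxOfLinearForms_eq (p : L → E →ₗ[𝕜] 𝕜) (x : E) :
    ∃ l, maxOfLinearForms p x = p l x := by
  obtain ⟨l, -, hl⟩ := Finset.exists_mem_eq_sup' Finset.univ_nonempty fun l => p l x
  exact ⟨l, hl⟩

variable [IsOrderedRing 𝕜]

/-- **The Lyapunov inequality between two max-of-linear-forms nodes is piecewise domination**:
`max_{l'} p' l' y ≤ c * max_l p l x` iff every piece of the target is dominated by `c` times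
some piece of the source (for `c ≥ 0`), pointwise.  (Uniformly in `x`, by LP duality, the edge
inequality between two polytopic nodes is the existence of a nonnegative matrix `H` with
`G_d A = H G_s`, `H w_s ≤ ε w_d` [AthanasopoulosJungers2019, Prop. 1]; not formalised.) [folklore] -/
theorem maxOfLinearForms_le_mul_maxOfLinearForms_iff {p' : L' → E →ₗ[𝕜] 𝕜}
    {p : L → E →ₗ[𝕜] 𝕜} {c : 𝕜} (hc : 0 ≤ c) {y x : E} :
    maxOfLinearForms p' y ≤ c * maxOfLinearForms p x ↔ ∀ l', ∃ l, p' l' y ≤ c * p l x := by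
  constructor
  · intro h l'
    obtain ⟨l, hl⟩ := exists_maxOfLinearForms_eq p x
    exact ⟨l, hl ▸ (le_maxOfLinearForms p' y l').trans h⟩
  · intro h
    rw [maxOfLinearForms_le_iff]
    intro l'
    obtain ⟨l, hl⟩ := h l'
    exact hl.trans (mul_le_mul_of_nonneg_left (le_maxOfLinearForms p x l) hc)

/-- Positive homogeneity of degree one. [folklore] -/
theorem maxOfLinearForms_smul (p : L → E →ₗ[𝕜] 𝕜) {t : 𝕜}
    (ht : 0 ≤ t) (x : E) : maxOfLinearForms p (t • x) = t * maxOfLinearForms p x := by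
  apply le_antisymm
  · rw [maxOfLinearForms_le_iff]
    intro l
    rw [map_smul, smul_eq_mul]
    exact mul_le_mul_of_nonneg_left (le_maxOfLinearForms p x l) ht
  · obtain ⟨l, hl⟩ := exists_maxOfLinearForms_eq p x
    rw [hl, ← smul_eq_mul, ← map_smul]
    exact le_maxOfLinearForms p (t • x) l

end MaxOfLinearForms

section Orthant

variable {ι : Type*} {𝕜 : Type*}

/-- The **nonnegative orthant** `{x | ∀ i, 0 ≤ x i}` of `ι → 𝕜` (`= Set.Ici 0`), the invariant
cone of entrywise-nonnegative matrix families (positive switched systems); Lyapunov functions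
required to work only there are called *copositive* (e.g. the linear copositive functions of
[MasonShorten2007]). [folklore] -/
def nonnegOrthant (ι : Type*) (𝕜 : Type*) [Zero 𝕜] [LE 𝕜] : Set (ι → 𝕜) :=
  {x | ∀ i, 0 ≤ x i}

/-- Membership in the nonnegative orthant is entrywise nonnegativity. [folklore] -/
@[simp] theorem mem_nonnegOrthant [Zero 𝕜] [LE 𝕜] {x : ι → 𝕜} :
    x ∈ nonnegOrthant ι 𝕜 ↔ ∀ i, 0 ≤ x i := Iff.rfl

/-- The nonnegative orthant is the order cone `Set.Ici 0` of the product order. [folklore] -/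
theorem nonnegOrthant_eq_Ici [Zero 𝕜] [Preorder 𝕜] : nonnegOrthant ι 𝕜 = Set.Ici 0 := by
  ext x; simp [Pi.le_def]

/-- Entrywise-nonnegative matrices preserve the nonnegative orthant. [folklore] -/
theorem mulVec_mem_nonnegOrthant [Fintype ι] [Semiring 𝕜] [PartialOrder 𝕜] [IsOrderedRing 𝕜]
    {M : Matrix ι ι 𝕜} (hM : ∀ i j, 0 ≤ M i j) {x : ι → 𝕜}
    (hx : x ∈ nonnegOrthant ι 𝕜) : M.mulVec x ∈ nonnegOrthant ι 𝕜 :=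
  fun i => by
    simp only [Matrix.mulVec, dotProduct]
    exact Finset.sum_nonneg fun j _ => mul_nonneg (hM i j) (hx j)

/-- Entrywise-nonnegative matrices map the nonnegative orthant into itself. [folklore] -/
theorem mapsTo_mulVec_nonnegOrthant [Fintype ι] [Semiring 𝕜] [PartialOrder 𝕜] [IsOrderedRing 𝕜]
    {M : Matrix ι ι 𝕜} (hM : ∀ i j, 0 ≤ M i j) :
    Set.MapsTo M.mulVec (nonnegOrthant ι 𝕜) (nonnegOrthant ι 𝕜) :=
  fun _ hx => mulVec_mem_nonnegOrthant hM hx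

end Orthant

section Polytopic

variable {ι m : Type*} {𝕜 : Type*} [Fintype ι] [CommRing 𝕜]

/-- The `2 · card m` signed rows `± (P x)_r` of a matrix `P`, as linear forms indexed by
`m × Bool` (`true` = `+`). [folklore] -/
def signedRows (P : Matrix m ι 𝕜) (rs : m × Bool) : (ι → 𝕜) →ₗ[𝕜] 𝕜 :=
  if rs.2 then (LinearMap.proj rs.1).comp (Matrix.mulVecLin P)
  else -((LinearMap.proj rs.1).comp (Matrix.mulVecLin P))

/-- The `+` rows. [folklore] -/
@[simp] theorem signedRows_apply_true (P : Matrix m ι 𝕜) (r : m) (x : ι → 𝕜) :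
    signedRows P (r, true) x = P.mulVec x r := by
  simp [signedRows]

/-- The `-` rows. [folklore] -/
@[simp] theorem signedRows_apply_false (P : Matrix m ι 𝕜) (r : m) (x : ι → 𝕜) :
    signedRows P (r, false) x = -P.mulVec x r := by
  simp [signedRows]

variable [Fintype m] [Nonempty m] [LinearOrder 𝕜]

/-- **Polytopic (∞-norm) template** `‖P x‖_∞ = max_r |(P x)_r|` for a matrix `P` with finitely
many (and at least one) rows; a norm iff `P` has trivial kernel, its unit ball the symmetric
polytope `{x | ‖Px‖_∞ ≤ 1} = {x | Gx ≤ 𝟙}` with `G = [P; -P]` [AthanasopoulosJungers2019, §III,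
(6), (8)].  It is the max of the `2 · card m` linear forms `± (row r of P)`
(`polytopicSeminorm_eq_maxOfLinearForms`), so its size as a max-of-linear-forms node is
`2 · card m`. [cite: AthanasopoulosJungers2019, §III, (8)] -/
def polytopicSeminorm (P : Matrix m ι 𝕜) (x : ι → 𝕜) : 𝕜 :=
  Finset.univ.sup' Finset.univ_nonempty fun r => |P.mulVec x r|

/-- Each `|(P x)_r|` is below `‖P x‖_∞`. [folklore] -/
theorem le_polytopicSeminorm (P : Matrix m ι 𝕜) (x : ι → 𝕜) (r : m) :
    |P.mulVec x r| ≤ polytopicSeminorm P x :=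
  Finset.le_sup' (fun r => |P.mulVec x r|) (Finset.mem_univ r)

/-- `‖P x‖_∞ ≤ a` iff every `|(P x)_r| ≤ a`. [folklore] -/
theorem polytopicSeminorm_le_iff {P : Matrix m ι 𝕜} {x : ι → 𝕜} {a : 𝕜} :
    polytopicSeminorm P x ≤ a ↔ ∀ r, |P.mulVec x r| ≤ a := by
  simp [polytopicSeminorm, Finset.sup'_le_iff]

variable [IsOrderedRing 𝕜]

/-- `‖P x‖_∞ ≥ 0` (at least one row). [folklore] -/
theorem polytopicSeminorm_nonneg (P : Matrix m ι 𝕜) (x : ι → 𝕜) : 0 ≤ polytopicSeminorm P x := by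
  obtain ⟨r⟩ := ‹Nonempty m›
  exact (abs_nonneg _).trans (le_polytopicSeminorm P x r)

omit [IsOrderedRing 𝕜] in
/-- `‖P x‖_∞` is the max of the `2 · card m` linear forms `± (P x)_r`. [folklore] -/
theorem polytopicSeminorm_eq_maxOfLinearForms (P : Matrix m ι 𝕜) (x : ι → 𝕜) :
    polytopicSeminorm P x = maxOfLinearForms (signedRows P) x := by
  apply le_antisymm
  · rw [polytopicSeminorm_le_iff]
    intro r
    rw [abs_le']
    exact ⟨by simpa using le_maxOfLinearForms (signedRows P) x (r, true),
      by simpa using le_maxOfLinearForms (signedRows P) x (r, false)⟩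
  · rw [maxOfLinearForms_le_iff]
    rintro ⟨r, _ | _⟩
    · simpa using (neg_le_abs _).trans (le_polytopicSeminorm P x r)
    · simpa using (le_abs_self _).trans (le_polytopicSeminorm P x r)

end Polytopic

section Quadratic

variable {ι : Type*} {𝕜 : Type*} [Fintype ι] [CommRing 𝕜]

/-- **Quadratic template** `x ↦ xᵀ Q x`; with `Q ≻ 0` the common quadratic Lyapunov function of
the semidefinite programme `P ≻ 0, γ² A_iᵀ P A_i ⪯ P` of [AhmadiEtAl2014, §1], and the node
functions of the max/min-of-quadratics certificates [AhmadiEtAl2014, §2 (graphs with two nodes)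
and §3].  Size: one `ι × ι` Gram matrix per node.
[cite: AhmadiEtAl2014, §1 (the SDP for a common quadratic Lyapunov function)] -/
def quadraticForm (Q : Matrix ι ι 𝕜) (x : ι → 𝕜) : 𝕜 :=
  x ⬝ᵥ Q.mulVec x

/-- Unfolding. [folklore] -/
theorem quadraticForm_apply (Q : Matrix ι ι 𝕜) (x : ι → 𝕜) :
    quadraticForm Q x = x ⬝ᵥ Q.mulVec x := rfl

/-- Homogeneity of degree two. [folklore] -/
theorem quadraticForm_smul (Q : Matrix ι ι 𝕜) (t : 𝕜) (x : ι → 𝕜) :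
    quadraticForm Q (t • x) = t ^ 2 * quadraticForm Q x := by
  simp only [quadraticForm, Matrix.mulVec_smul, dotProduct_smul, smul_dotProduct, smul_eq_mul]
  ring

/-- Pulling a quadratic node function back along a letter: `(A x)ᵀ Q (A x) = xᵀ (Aᵀ Q A) x`, so
the edge inequality `V_j (A x) ≤ c V_i (x)` between quadratic nodes is the matrix inequality
`Aᵀ Q_j A ⪯ c Q_i` of AJPR's semidefinite programmes.
[cite: AhmadiEtAl2014, §1 (the SDP for a common quadratic Lyapunov function) and §2] -/
theorem quadraticForm_mulVec (Q A : Matrix ι ι 𝕜) (x : ι → 𝕜) :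
    quadraticForm Q (A.mulVec x) = quadraticForm (A.transpose * Q * A) x := by
  simp only [quadraticForm, ← Matrix.mulVec_mulVec, Matrix.dotProduct_mulVec x A.transpose,
    Matrix.vecMul_transpose]

end Quadratic

section SOS

variable {ι : Type*} {σ : Type*} {𝕜 : Type*} [Fintype ι] [CommRing 𝕜]

open MvPolynomial in
/-- The linear change of variables `x ↦ M x` on polynomials in the coordinates `X i`, `i : ι`:
`linSubst M p = p (∑_j M i j X j)_i`, so that `eval x (linSubst M p) = eval (M x) p`
(`eval_linSubst`). [folklore] -/
noncomputable def linSubst (M : Matrix ι ι 𝕜) (p : MvPolynomial ι 𝕜) : MvPolynomial ι 𝕜 :=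
  bind₁ (fun i : ι => ∑ j, C (M i j) * X j) p

open MvPolynomial in
/-- `(linSubst M p) (x) = p (M x)`. [folklore] -/
@[simp] theorem eval_linSubst (M : Matrix ι ι 𝕜) (p : MvPolynomial ι 𝕜) (x : ι → 𝕜) :
    eval x (linSubst M p) = eval (M.mulVec x) p := by
  have h : (fun i => eval x (∑ j, C (M i j) * X j)) = M.mulVec x := by
    funext i
    simp [Matrix.mulVec, dotProduct]
  rw [← h]
  exact eval₂Hom_bind₁ _ _ _ _

omit [Fintype ι] in
open MvPolynomial in
/-- A form of degree `n` is a homogeneous FUNCTION of degree `n`: `p (t • x) = tⁿ p x`.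
[folklore] -/
theorem eval_smul_of_isHomogeneous {φ : MvPolynomial ι 𝕜} {n : ℕ} (hφ : φ.IsHomogeneous n)
    (t : 𝕜) (x : ι → 𝕜) : eval (t • x) φ = t ^ n * eval x φ := by
  classical
  conv_lhs => rw [φ.as_sum]
  conv_rhs => rw [φ.as_sum]
  rw [map_sum, map_sum, Finset.mul_sum]
  refine Finset.sum_congr rfl fun d hd => ?_
  have hdeg : ∑ i ∈ d.support, d i = n := by
    have := hφ (mem_support_iff.mp hd)
    simpa [Finsupp.weight_apply, Finsupp.sum] using this
  simp only [eval_monomial, Pi.smul_apply, smul_eq_mul, mul_pow, Finsupp.prod,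
    Finset.prod_mul_distrib, Finset.prod_pow_eq_pow_sum, hdeg]
  ring

variable [LinearOrder 𝕜] [IsStrictOrderedRing 𝕜]

open MvPolynomial in
/-- **Sum-of-squares Lyapunov certificate of degree `2d` and rate `γ`** for the matrix family
`A` (the Parrilo–Jadbabaie programme defining `ρ_{SOS,2d}`): a form `p`, homogeneous of degree
`2d` (`d ≥ 1`), such that `p - ε (∑ᵢ Xᵢ²)ᵈ` is a sum of squares of polynomials for some `ε > 0`
(the strict-positivity normalisation of [ParriloJadbabaie2008, Rem. 2.5]) and
`γ^{2d} p - p ∘ A_b` is a sum of squares for every letter `b` [ParriloJadbabaie2008, §2.1,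
programme (ρ_{SOS,2d})].  By [ParriloJadbabaie2008, Thm. 2.2] such a `p` certifies
`ρ(𝒜) ≤ γ`; its SIZE is the degree `2d` (an SDP over `ι`-variate forms of degree `2d`).
"Sum of squares" is Mathlib's `IsSumSq` in the ring `MvPolynomial ι 𝕜`.
[cite: ParriloJadbabaie2008, §2.1 and Thm. 2.2, Rem. 2.5] -/
structure IsSosLyapunovCertificate (A : σ → Matrix ι ι 𝕜) (γ : 𝕜) (d : ℕ) (p : MvPolynomial ι 𝕜) :
    Prop where
  one_le_deg : 1 ≤ d
  isHomogeneous : p.IsHomogeneous (2 * d)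
  exists_sub_isSumSq : ∃ ε : 𝕜, 0 < ε ∧ IsSumSq (p - C ε * (∑ i, X i ^ 2) ^ d)
  isSumSq_decrease : ∀ b, IsSumSq (C (γ ^ (2 * d)) * p - linSubst (A b) p)

/-- Ring homomorphisms preserve sums of squares. [folklore] -/
theorem isSumSq_map_ringHom {R S : Type*} [Semiring R] [Semiring S] (f : R →+* S) {x : R}
    (hx : IsSumSq x) : IsSumSq (f x) := by
  induction hx with
  | zero => simp
  | sq_add a hs ih => simpa using IsSumSq.sq_add (f a) ih

omit [Fintype ι] in
open MvPolynomial in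
/-- Values of a sum of squares of polynomials are nonnegative. [folklore] -/
theorem eval_nonneg_of_isSumSq {p : MvPolynomial ι 𝕜} (hp : IsSumSq p) (x : ι → 𝕜) :
    0 ≤ eval x p :=
  (isSumSq_map_ringHom (eval x) hp).nonneg

open MvPolynomial in
/-- The SOS decrease condition gives the common Lyapunov inequality
`p (A_b x) ≤ γ^{2d} p (x)` [ParriloJadbabaie2008, Thm. 2.2 via (ρ_{SOS,2d})].
[cite: ParriloJadbabaie2008, §2.1] -/
theorem IsSosLyapunovCertificate.eval_mulVec_le {A : σ → Matrix ι ι 𝕜} {γ : 𝕜} {d : ℕ}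
    {p : MvPolynomial ι 𝕜} (h : IsSosLyapunovCertificate A γ d p) (b : σ) (x : ι → 𝕜) :
    eval ((A b).mulVec x) p ≤ γ ^ (2 * d) * eval x p := by
  have := eval_nonneg_of_isSumSq (h.isSumSq_decrease b) x
  simp only [map_sub, map_mul, eval_C, eval_linSubst] at this
  linarith

open MvPolynomial in
/-- The strict-positivity normalisation gives `ε (∑ xᵢ²)ᵈ ≤ p x`. [cite: ParriloJadbabaie2008, Rem. 2.5] -/
theorem IsSosLyapunovCertificate.exists_mul_pow_le_eval {A : σ → Matrix ι ι 𝕜} {γ : 𝕜} {d : ℕ}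
    {p : MvPolynomial ι 𝕜} (h : IsSosLyapunovCertificate A γ d p) :
    ∃ ε : 𝕜, 0 < ε ∧ ∀ x : ι → 𝕜, ε * (∑ i, x i ^ 2) ^ d ≤ eval x p := by
  obtain ⟨ε, hε, hs⟩ := h.exists_sub_isSumSq
  refine ⟨ε, hε, fun x => ?_⟩
  have := eval_nonneg_of_isSumSq hs x
  simp only [map_sub, map_mul, eval_C, map_pow, map_sum, eval_X] at this
  linarith

open MvPolynomial in
/-- Node function of an SOS certificate: positive definite. [cite: ParriloJadbabaie2008, Thm. 2.2] -/
theorem IsSosLyapunovCertificate.eval_pos {A : σ → Matrix ι ι 𝕜} {γ : 𝕜} {d : ℕ}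
    {p : MvPolynomial ι 𝕜} (h : IsSosLyapunovCertificate A γ d p) {x : ι → 𝕜} (hx : x ≠ 0) :
    0 < eval x p := by
  obtain ⟨ε, hε, hle⟩ := h.exists_mul_pow_le_eval
  obtain ⟨i, hi⟩ : ∃ i, x i ≠ 0 := Function.ne_iff.mp hx
  have hs : 0 < ∑ j, x j ^ 2 :=
    Finset.sum_pos' (fun j _ => sq_nonneg (x j)) ⟨i, Finset.mem_univ i, sq_pos_iff.mpr hi⟩
  exact (mul_pos hε (pow_pos hs d)).trans_le (hle x)

omit [IsStrictOrderedRing 𝕜] in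
open MvPolynomial in
/-- Node function of an SOS certificate: homogeneous of degree `2d`.
[cite: ParriloJadbabaie2008, Thm. 2.2] -/
theorem IsSosLyapunovCertificate.eval_smul {A : σ → Matrix ι ι 𝕜} {γ : 𝕜} {d : ℕ}
    {p : MvPolynomial ι 𝕜} (h : IsSosLyapunovCertificate A γ d p) (t : 𝕜) (x : ι → 𝕜) :
    eval (t • x) p = t ^ (2 * d) * eval x p :=
  eval_smul_of_isHomogeneous h.isHomogeneous t x

open MvPolynomial in
/-- **An SOS certificate is a path-complete graph Lyapunov function** on the one-node complete
graph (a common Lyapunov function), with factor `γ^{2d}` on the whole space.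
[cite: ParriloJadbabaie2008, Thm. 2.2] -/
theorem IsSosLyapunovCertificate.isPathCompleteLyapunov {A : σ → Matrix ι ι 𝕜} {γ : 𝕜} {d : ℕ}
    {p : MvPolynomial ι 𝕜} (h : IsSosLyapunovCertificate A γ d p) :
    IsPathCompleteLyapunov (LabeledDigraph.complete σ Unit) (fun b x => (A b).mulVec x) Set.univ
      (γ ^ (2 * d)) (fun _ x => eval x p) :=
  IsPathCompleteLyapunov.of_common fun b x _ => h.eval_mulVec_le b x

end SOS

end Literature.Dynamics.SwitchedSystems
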